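/-
Copyright (c) 2026 the pub-hodgecm-mathlib formalisation cell (harness21).  Prover seat hodgecm-mathlib-R90-C10-p07 (g0) acting for R90-TF section S8 «ContSpec-n½»
(dealer R90-CS-plan (g2), S8-R38 (4) «B1-local»): the χ-TWISTED UNRAMIFIED LOCAL FACTOR of the `U(2,1)` intertwining ∕ constant-term Euler product at a good
NON-SPLIT place, at COMPLEX exponent, and the complexified spherical local tokens at every good place (N = 3).
-/
import Summits.HodgeConjecture.HodgeConjecture.Theorems.K2E1IntertwiningLocalMeanCMU3           -- ★ real-`σ` local tokens at good places (`localMean_eq_localScalar_of_nonsplit ∕ _of_split`)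
import Summits.HodgeConjecture.HodgeConjecture.Theorems.K2E1IntertwiningLocalFactorHolomorphicU3 -- ★ `differentiableOn_inv_smul_integral_localHeight_cpow_neg` (holomorphy in complex `z`)
import Literature.NumberTheory.LFunctions.PrimeLogSeries                                       -- ★ `frequently_ofReal_gt`, `isPreconnected_re_gt` (identity-theorem plumbing)
import HarnessLib

/-!
# K2·E1 ∕ R90·S8 — `K2E1ChiIntertwiningLocalScalarU3` (B1-local): THE `χ`-TWISTED UNRAMIFIED LOCAL FACTOR OF THE `U(2,1)` INTERTWINING EULER PRODUCT AT A GOOD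
# NON-SPLIT PLACE — `ν(𝒪_v³)⁻¹·∫ ω_v·Q_v^{−z} = (1 − e q_v^{−2z})(1 + e q_v^{−(2z−1)}) ∕ ((1 − e q_v^{−(2z−2)})(1 + e q_v^{−(2z−2)}))` for SHELL-GEOMETRIC weights `ω_v = e^k` on
# `{Q_v = q_v^{2k}}` — and the COMPLEXIFIED spherical tokens at every good place

Cell `pub/hodgecm-mathlib`, crux h413 = `stmt-HodgeConjecture-24833`, route of record `HCCMUnconditional`; R90-TF section S8, socket #3 `sock_S8_res_piN_occurs` road (census
`R90/S8/CENSUS-sock3-piN.R90-C10-p07-g0.md` item B1) and R90-C14-p02's #2 chain (file F4 `K2E1ChiIntertwiningScalarEulerQuotientU3`, R90-CS-p03, imports this file BY NAME).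
THEOREMS ONLY (no `def`, no `instance`, no notation, no named-fact hypothesis, no `sorry`; default heartbeats); lane `--supports stmt-HodgeConjecture-24833 --as helper`.

THE MATHEMATICS ([Rogawski1990] §13.9 p. 229: `M(s) = L(s,φ)L(2s,φ′ω)∕(L(s+1,φ)L(2s+1,φ′ω))`; [Langlands1971] §3; [Langlands1976] Appendix; K. F. Lai, Compositio 41 (1980) §3).  At a good finite place `v` of `L⁺` the local height
`Q_v(p) = ∏_{w∣v} max(1, ‖X_w‖, ‖Z_w‖)` of the `U(2,1)` big cell in base coordinates `p ∈ (L⁺_v)³` (★ `K2E1IntertwiningLocalHeightU3`, written out) has the SPHERICAL local mean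
`ν(𝒪_v³)⁻¹·∫ Q_v^{−σ}` computed for REAL `σ > 1` (★ `K2E1IntertwiningLocalMeanCMU3`) and is holomorphic in COMPLEX `z` on `{1 < Re z}` (★ `K2E1IntertwiningLocalFactorHolomorphicU3`); §1
passes the tokens to complex `z` by the identity theorem.  NORMALISATION: E1's `z` at `N = 3` is Rogawski's `s + 1` (middle point `s = ½ ↔ z = 3∕2`).  At a NON-SPLIT good `v` (`q_w = q_v²`)
`Q_v ∈ q_v^{2ℕ}`, and the weight of an UNRAMIFIED `χ = (φ, ψ)` along the big cell is SHELL-GEOMETRIC: `ω_v = e^k` on the shell `{Q_v = q_v^{2k}}` with `e = φ_w(ϖ_w)`, `‖e‖ = 1`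
(this SHELL LETTER `hshell` is the (W)-side local algebra, discharged in a separate brick).  Writing `e = exp(θ I)`, `t = −θ∕(2 log q_v)`: POINTWISE `ω_v·Q_v^{−z} = Q_v^{−(z + tI)}` (§2),
so the χ-mean at `z` is the spherical mean at the complex exponent `z + tI`, and §1 gives (§3, HEAD)
  **`ν(𝒪_v³)⁻¹·∫ ω_v·Q_v^{−z} dν³ = (1 − e·q_v^{−2z})(1 + e·q_v^{−(2z−1)}) ∕ ((1 − e·q_v^{−(2z−2)})(1 + e·q_v^{−(2z−2)}))`**  (`1 < Re z`)
= the `v`-factor of `L(s,φ)L_{L⁺}(2s,φ′ω)∕(L(s+1,φ)L_{L⁺}(2s+1,φ′ω))` at `s = z − 1` (`φ_w(ϖ_v) = e`, `ω_{L∕L⁺,v}(ϖ_v) = −1`); at `e = 1` it is ★'s spherical token, token for token.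
HONEST SCOPE.  NOT here: the SHELL LETTER for the actual Iwasawa weight of `ι(w₀)·u(X,Z)` (the `N = 3` twin of ★ `K2E1ChiLocalWeightShellU2`); the SPLIT χ-token (two exponents
`z ± tI` on the Gindikin–Karpelevich cell — ★ carries one exponent) = sequel `K2E1ChiIntertwiningLocalScalarSplitU3`; the global Euler product (F4).
HONEST LABEL: HC_CM is proved only modulo the 7 printed citations (2 remaining named inputs: hLiu418 = `stmt-HodgeConjecture-24832`, h413 = `stmt-HodgeConjecture-24833`) until rung 0
closes; this file asserts no named fact and closes no socket; count-neutral; unconditional local analysis.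

* §0 generic: `mul_integral_cpow_eq_of_real` (identity theorem: a real-`σ` token for `c·∫ Q^{−σ}` extends to `{1 < Re}`), `differentiableOn_localScalarToken` (the token is holomorphic there).
* §1 **`localMean_cpow_eq_localScalar_of_nonsplit`**, **`localMean_cpow_eq_localScalar_of_split`** — ★'s tokens at COMPLEX `ζ`, `1 < Re ζ`.
* §2 `exists_half_angle` — the half-angle data `q^{−tI} = e'`, `e'² = e`, `q^{−2tI} = e` and the exponent shift `e^k·(q^{2k})^{−z} = (q^{2k})^{−(z+tI)}` for shell-geometric weights.
* §3 HEAD **`chiLocalMean_eq_token_of_shell_nonsplit`**.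

## References
* [Rogawski1990] J. D. Rogawski, *Automorphic Representations of Unitary Groups in Three Variables* (1990), §13.9 p. 229; §4.5.
* [Langlands1971] R. P. Langlands, *Euler Products* (1971), §3.
* [Langlands1976] R. P. Langlands, *On the Functional Equations Satisfied by Eisenstein Series*, LNM 544 (1976), Appendix (rank one).
* [MoeglinWaldspurger1995] C. Mœglin, J.-L. Waldspurger, *Spectral Decomposition and Eisenstein Series* (1995), II.1.7, IV.1.11.
-/

set_option autoImplicit false
set_option linter.dupNamespace false -- the mandated namespace repeats `HodgeConjecture.HodgeConjecture`

noncomputable section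

open MeasureTheory NumberField IsDedekindDomain Filter Set Complex
open scoped NNReal ENNReal Topology
open Literature.NumberTheory.Automorphic Literature.NumberTheory.Automorphic.UnitaryGroup Literature.NumberTheory.GaloisRepresentations
open Literature.NumberTheory.GaloisRepresentations.IsNonarchimedeanLocalField
open Literature.NumberTheory.LFunctions.Nicolas (frequently_ofReal_gt isPreconnected_re_gt)
open Summit.HodgeConjecture.HodgeConjecture.Cruxes.H413.K2E1QuadraticHeckeCharCMPlaceValues
open Summit.HodgeConjecture.HodgeConjecture.Cruxes.H413.K2E1IntertwiningLocalMeanCMU3 (localMean_eq_localScalar_of_nonsplit localMean_eq_localScalar_of_split)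
open Summit.HodgeConjecture.HodgeConjecture.Cruxes.H413.K2E1IntertwiningLocalFactorHolomorphicU3 (differentiableOn_inv_smul_integral_localHeight_cpow_neg)

namespace Summit.HodgeConjecture.HodgeConjecture.Cruxes.H413.K2E1ChiIntertwiningLocalScalarU3

/-! ## §0 Generic: identity theorem on `{1 < Re}`; holomorphy of the local token -/

section Generic

/-- **IDENTITY-THEOREM TRANSFER.**  If `z ↦ c • ∫ Q^{−z} dμ` is holomorphic on `{1 < Re z}` (`Q ≥ 0` pointwise), `T` is holomorphic there, and for every REAL `σ > 1` the real-power
mean `c • ∫ ((Q^{−σ} : ℝ) : ℂ) dμ` equals `T σ`, then `(c : ℂ)·∫ Q^{−ζ} dμ = T ζ` for every `ζ` with `1 < Re ζ` (pointwise `((Q^{−σ}:ℝ):ℂ) = (Q:ℂ)^{−σ}`, ★ `frequently_ofReal_gt`,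
Mathlib `AnalyticOnNhd.eqOn_of_preconnected_of_frequently_eq`). [folklore] -/
theorem mul_integral_cpow_eq_of_real {α : Type*} [MeasurableSpace α] {μ : Measure α} {Q : α → ℝ} (hQ : ∀ a, 0 ≤ Q a) (c : ℝ) {T : ℂ → ℂ}
    (hT : DifferentiableOn ℂ T {z : ℂ | 1 < z.re})
    (hΦ : DifferentiableOn ℂ (fun z : ℂ => c • ∫ a, ((Q a : ℝ) : ℂ) ^ (-z) ∂μ) {z : ℂ | 1 < z.re})
    (hreal : ∀ σ : ℝ, 1 < σ → c • ∫ a, (((Q a) ^ (-σ) : ℝ) : ℂ) ∂μ = T σ) {ζ : ℂ} (hζ : 1 < ζ.re) :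
    ((c : ℝ) : ℂ) * ∫ a, ((Q a : ℝ) : ℂ) ^ (-ζ) ∂μ = T ζ := by
  have hopen : IsOpen {z : ℂ | 1 < z.re} := isOpen_lt continuous_const Complex.continuous_re
  have hA : AnalyticOnNhd ℂ (fun z : ℂ => c • ∫ a, ((Q a : ℝ) : ℂ) ^ (-z) ∂μ) {z : ℂ | 1 < z.re} :=
    (Complex.analyticOnNhd_iff_differentiableOn hopen).2 hΦ
  have hB : AnalyticOnNhd ℂ T {z : ℂ | 1 < z.re} := (Complex.analyticOnNhd_iff_differentiableOn hopen).2 hT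
  have h2 : (2 : ℂ) ∈ {z : ℂ | 1 < z.re} := by
    show (1 : ℝ) < (2 : ℂ).re
    norm_num
  have hfreq : ∃ᶠ z in 𝓝[≠] ((2 : ℝ) : ℂ), (fun z : ℂ => c • ∫ a, ((Q a : ℝ) : ℂ) ^ (-z) ∂μ) z = T z := by
    refine frequently_ofReal_gt (a := 1) (by norm_num) fun σ hσ => ?_
    show c • ∫ a, ((Q a : ℝ) : ℂ) ^ (-(σ : ℂ)) ∂μ = T σ
    rw [← hreal σ hσ]
    congr 1
    refine integral_congr_ae (Eventually.of_forall fun a => ?_)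
    show ((Q a : ℝ) : ℂ) ^ (-(σ : ℂ)) = (((Q a) ^ (-σ) : ℝ) : ℂ)
    rw [Complex.ofReal_cpow (hQ a) (-σ), Complex.ofReal_neg]
  have h2' : ((2 : ℝ) : ℂ) ∈ {z : ℂ | 1 < z.re} := by
    rw [Complex.ofReal_ofNat]; exact h2
  have hEq := hA.eqOn_of_preconnected_of_frequently_eq hB (isPreconnected_re_gt 1) h2' hfreq
  have h := hEq hζ
  simp only [Complex.real_smul] at h
  exact h

/-- **THE LOCAL TOKEN IS HOLOMORPHIC ON `{1 < Re}`**: for a natural number `q > 1` and `ε ∈ ℂ` with `‖ε‖ ≤ 1`,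
`ζ ↦ (1−q^{−ζ})(1−ε q^{−ζ})(1−ε q^{−(2ζ−1)}) ∕ ((1−q^{−(ζ−1)})(1−ε q^{−(ζ−1)})(1−ε q^{−(2ζ−2)}))` is differentiable on `{1 < Re ζ}` (the denominator has norm-`< 1` subtrahends there).
[folklore] -/
theorem differentiableOn_localScalarToken {q : ℕ} (hq : 1 < q) {ε : ℂ} (hε : ‖ε‖ ≤ 1) :
    DifferentiableOn ℂ (fun ζ : ℂ =>
      (1 - (q : ℂ) ^ (-ζ)) * (1 - ε * (q : ℂ) ^ (-ζ)) * (1 - ε * (q : ℂ) ^ (-(2 * ζ - 1))) /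
        ((1 - (q : ℂ) ^ (-(ζ - 1))) * (1 - ε * (q : ℂ) ^ (-(ζ - 1))) * (1 - ε * (q : ℂ) ^ (-(2 * ζ - 2))))) {z : ℂ | 1 < z.re} := by
  have hq0 : (q : ℂ) ≠ 0 := by exact_mod_cast (show q ≠ 0 by omega)
  have hqpos : 0 < q := by omega
  have hq1 : (1 : ℝ) < (q : ℝ) := by exact_mod_cast hq
  -- each `ζ ↦ q^{a·ζ + b}` is entire
  have hpow : ∀ w : ℂ → ℂ, Differentiable ℂ w → Differentiable ℂ fun ζ => (q : ℂ) ^ (w ζ) :=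
    fun w hw ζ => (hw ζ).const_cpow (Or.inl hq0)
  have hd1 : Differentiable ℂ fun ζ : ℂ => (q : ℂ) ^ (-ζ) := hpow _ differentiable_neg
  have hd2 : Differentiable ℂ fun ζ : ℂ => (q : ℂ) ^ (-(2 * ζ - 1)) :=
    hpow _ (((differentiable_const _).mul differentiable_id).sub (differentiable_const _)).neg
  have hd3 : Differentiable ℂ fun ζ : ℂ => (q : ℂ) ^ (-(ζ - 1)) := hpow _ (differentiable_id.sub (differentiable_const _)).neg
  have hd4 : Differentiable ℂ fun ζ : ℂ => (q : ℂ) ^ (-(2 * ζ - 2)) :=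
    hpow _ (((differentiable_const _).mul differentiable_id).sub (differentiable_const _)).neg
  -- norms of the denominators' subtrahends are `< 1` on `{1 < Re}`
  have hnorm : ∀ (w : ℂ), w.re < 0 → ‖(q : ℂ) ^ w‖ < 1 := fun w hw => by
    rw [Complex.norm_natCast_cpow_of_pos hqpos]
    exact Real.rpow_lt_one_of_one_lt_of_neg hq1 hw
  have hne : ∀ (a w : ℂ), ‖a‖ ≤ 1 → w.re < 0 → 1 - a * (q : ℂ) ^ w ≠ 0 := fun a w ha hw => by
    intro h
    have h1 : a * (q : ℂ) ^ w = 1 := by linear_combination -h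
    have h2 : ‖a * (q : ℂ) ^ w‖ < 1 := by
      rw [norm_mul]
      calc ‖a‖ * ‖(q : ℂ) ^ w‖ ≤ 1 * ‖(q : ℂ) ^ w‖ := by gcongr
        _ < 1 := by rw [one_mul]; exact hnorm w hw
    rw [h1, norm_one] at h2
    exact lt_irrefl _ h2
  refine DifferentiableOn.div ?_ ?_ ?_
  · exact ((((differentiable_const _).sub hd1).mul ((differentiable_const _).sub ((differentiable_const _).mul hd1))).mul
      ((differentiable_const _).sub ((differentiable_const _).mul hd2))).differentiableOn
  · exact ((((differentiable_const _).sub hd3).mul ((differentiable_const _).sub ((differentiable_const _).mul hd3))).mul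
      ((differentiable_const _).sub ((differentiable_const _).mul hd4))).differentiableOn
  · intro ζ hζ
    have hζ' : 1 < ζ.re := hζ
    have hr1 : (-(ζ - 1)).re < 0 := by simp; linarith
    have hr2 : (-(2 * ζ - 2)).re < 0 := by simp; linarith
    refine mul_ne_zero (mul_ne_zero ?_ (hne ε _ hε hr1)) (hne ε _ hε hr2)
    have h := hne 1 _ (by rw [norm_one]) hr1
    rwa [one_mul] at h

end Generic

variable (L : Type) [Field L] [NumberField L] [IsCMField L] {δ : L} (hcδ : IsCMField.complexConj L δ = -δ) (hδ : δ ≠ 0)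
  {d : ↥(maximalRealSubfield L)} (hd : δ * δ = algebraMap ↥(maximalRealSubfield L) L d)
  (v : HeightOneSpectrum (𝓞 ↥(maximalRealSubfield L)))
  [MeasurableSpace (v.adicCompletion ↥(maximalRealSubfield L))] [BorelSpace (v.adicCompletion ↥(maximalRealSubfield L))]
  (ν : Measure (v.adicCompletion ↥(maximalRealSubfield L))) [ν.IsAddHaarMeasure]

/-! ## §1 The spherical local tokens at COMPLEX exponent (every good place) -/

include hd in
/-- **THE SPHERICAL LOCAL MEAN AT A GOOD NON-SPLIT PLACE, COMPLEX EXPONENT**: for `1 < Re ζ`,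
`ν(𝒪_v³)⁻¹·∫ Q_v^{−ζ} dν³ = (1−q^{−ζ})(1−ε_v q^{−ζ})(1−ε_v q^{−(2ζ−1)}) ∕ ((1−q^{−(ζ−1)})(1−ε_v q^{−(ζ−1)})(1−ε_v q^{−(2ζ−2)}))`, `ε = quadraticHeckeCharCM L` (`ε_v = −1` here) — ★
`localMean_eq_localScalar_of_nonsplit` (real `σ`) continued by the identity theorem (§0) along ★ `differentiableOn_inv_smul_integral_localHeight_cpow_neg`.
[cite: Langlands1971, §3] [cite: Rogawski1990, §4.5] [cite: MoeglinWaldspurger1995, IV.1.11] -/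
theorem localMean_cpow_eq_localScalar_of_nonsplit (hunr : Algebra.IsUnramifiedIn (𝓞 L) v.asIdeal) (w : PlacesOver L v) (hw : IsCMField.complexConj L • w.1 = w.1)
    (h2 : Valued.v (2 : v.adicCompletion ↥(maximalRealSubfield L)) = 1) (hδu : Valued.v (algebraMap L (LocalRing L v) δ w) = 1) {ζ : ℂ} (hζ : 1 < ζ.re) :
    ((((Measure.pi fun _ : Fin 3 => ν) (integralBox ↥(maximalRealSubfield L) (Fin 3) v)).toReal⁻¹ : ℝ) : ℂ) *
      ∫ p : Fin 3 → v.adicCompletion ↥(maximalRealSubfield L),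
        (((∏ w' : PlacesOver L v, max 1 (max ((normAbs (w'.1.adicCompletion L) (quadraticLocalEquiv L v (IsCMField.complexConj L) hcδ hδ (p 0, p 1) w') : ℝ≥0) : ℝ)
          ((normAbs (w'.1.adicCompletion L) ((toLocalRing L v (p 2) * algebraMap L (LocalRing L v) δ -
            toLocalRing L v 2⁻¹ * (quadraticLocalEquiv L v (IsCMField.complexConj L) hcδ hδ (p 0, p 1) *
              conjLocal L (IsCMField.complexConj L) v (quadraticLocalEquiv L v (IsCMField.complexConj L) hcδ hδ (p 0, p 1)))) w') : ℝ≥0) : ℝ))) : ℝ) : ℂ) ^ (-ζ)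
        ∂(Measure.pi fun _ : Fin 3 => ν) =
      (1 - (v.residueCard : ℂ) ^ (-ζ)) * (1 - (quadraticHeckeCharCM L).valueAtUniformizer v * (v.residueCard : ℂ) ^ (-ζ)) *
          (1 - (quadraticHeckeCharCM L).valueAtUniformizer v * (v.residueCard : ℂ) ^ (-(2 * ζ - 1))) /
        ((1 - (v.residueCard : ℂ) ^ (-(ζ - 1))) * (1 - (quadraticHeckeCharCM L).valueAtUniformizer v * (v.residueCard : ℂ) ^ (-(ζ - 1))) *
          (1 - (quadraticHeckeCharCM L).valueAtUniformizer v * (v.residueCard : ℂ) ^ (-(2 * ζ - 2)))) := by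
  have hε : ‖(quadraticHeckeCharCM L).valueAtUniformizer v‖ ≤ 1 := by
    rw [valueAtUniformizer_quadraticHeckeCharCM_of_nonsplit L v w hw hunr, norm_neg, norm_one]
  refine mul_integral_cpow_eq_of_real (fun p => le_trans zero_le_one (Finset.one_le_prod fun w' _ => le_max_left _ _)) _
    (differentiableOn_localScalarToken v.one_lt_residueCard hε)
    (differentiableOn_inv_smul_integral_localHeight_cpow_neg L hcδ hδ hd v ν) (fun σ hσ => ?_) hζ
  exact localMean_eq_localScalar_of_nonsplit L hcδ hδ hd v ν hunr w hw h2 hδu hσ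

include hd in
/-- **THE SPHERICAL LOCAL MEAN AT A GOOD SPLIT PLACE, COMPLEX EXPONENT**: the same token (`ε_v = +1` here) for `1 < Re ζ` — ★ `localMean_eq_localScalar_of_split` continued by §0.
[cite: Langlands1971, §3] [cite: MoeglinWaldspurger1995, II.1.7] -/
theorem localMean_cpow_eq_localScalar_of_split (w : PlacesOver L v) (hw : IsCMField.complexConj L • w.1 ≠ w.1)
    (h2 : Valued.v (2 : v.adicCompletion ↥(maximalRealSubfield L)) = 1) (hδu : Valued.v (algebraMap L (LocalRing L v) δ w) = 1) {ζ : ℂ} (hζ : 1 < ζ.re) :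
    ((((Measure.pi fun _ : Fin 3 => ν) (integralBox ↥(maximalRealSubfield L) (Fin 3) v)).toReal⁻¹ : ℝ) : ℂ) *
      ∫ p : Fin 3 → v.adicCompletion ↥(maximalRealSubfield L),
        (((∏ w' : PlacesOver L v, max 1 (max ((normAbs (w'.1.adicCompletion L) (quadraticLocalEquiv L v (IsCMField.complexConj L) hcδ hδ (p 0, p 1) w') : ℝ≥0) : ℝ)
          ((normAbs (w'.1.adicCompletion L) ((toLocalRing L v (p 2) * algebraMap L (LocalRing L v) δ -
            toLocalRing L v 2⁻¹ * (quadraticLocalEquiv L v (IsCMField.complexConj L) hcδ hδ (p 0, p 1) *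
              conjLocal L (IsCMField.complexConj L) v (quadraticLocalEquiv L v (IsCMField.complexConj L) hcδ hδ (p 0, p 1)))) w') : ℝ≥0) : ℝ))) : ℝ) : ℂ) ^ (-ζ)
        ∂(Measure.pi fun _ : Fin 3 => ν) =
      (1 - (v.residueCard : ℂ) ^ (-ζ)) * (1 - (quadraticHeckeCharCM L).valueAtUniformizer v * (v.residueCard : ℂ) ^ (-ζ)) *
          (1 - (quadraticHeckeCharCM L).valueAtUniformizer v * (v.residueCard : ℂ) ^ (-(2 * ζ - 1))) /
        ((1 - (v.residueCard : ℂ) ^ (-(ζ - 1))) * (1 - (quadraticHeckeCharCM L).valueAtUniformizer v * (v.residueCard : ℂ) ^ (-(ζ - 1))) *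
          (1 - (quadraticHeckeCharCM L).valueAtUniformizer v * (v.residueCard : ℂ) ^ (-(2 * ζ - 2)))) := by
  have hε : ‖(quadraticHeckeCharCM L).valueAtUniformizer v‖ ≤ 1 := by
    rw [valueAtUniformizer_quadraticHeckeCharCM_of_split L v w hw, norm_one]
  refine mul_integral_cpow_eq_of_real (fun p => le_trans zero_le_one (Finset.one_le_prod fun w' _ => le_max_left _ _)) _
    (differentiableOn_localScalarToken v.one_lt_residueCard hε)
    (differentiableOn_inv_smul_integral_localHeight_cpow_neg L hcδ hδ hd v ν) (fun σ hσ => ?_) hζ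
  exact localMean_eq_localScalar_of_split L hcδ hδ hd v ν w hw h2 hδu hσ

/-! ## §2 The exponent shift for shell-geometric weights -/

section Shift

/-- **HALF-ANGLE DATA of a unit complex number**: for `‖e‖ = 1` and a real `q > 1` there are a real `t` and `e' ∈ ℂ` with `q^{−tI} = e'`, `e'² = e`, `q^{−2tI} = e`, and
`e^k · (q^{2k})^{−z} = (q^{2k})^{−(z + tI)}` for all `k : ℕ`, `z : ℂ` (`e = exp(θI)`, `θ = arg e`, `t = −θ∕(2 log q)`, `e' = exp(θI∕2)`). [folklore] -/
theorem exists_half_angle {e : ℂ} (he : ‖e‖ = 1) {q : ℝ} (hq : 1 < q) :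
    ∃ (t : ℝ) (e' : ℂ), (q : ℂ) ^ (-(t * I)) = e' ∧ e' ^ 2 = e ∧ (q : ℂ) ^ (-(2 * (t * I))) = e ∧
      ∀ (k : ℕ) (z : ℂ), e ^ k * (((q ^ (2 * k) : ℝ)) : ℂ) ^ (-z) = (((q ^ (2 * k) : ℝ)) : ℂ) ^ (-(z + t * I)) := by
  have hq0 : (0 : ℝ) < q := lt_trans zero_lt_one hq
  have hlog : Real.log q ≠ 0 := Real.log_ne_zero_of_pos_of_ne_one hq0 (ne_of_gt hq)
  have hqC : (q : ℂ) ≠ 0 := by exact_mod_cast hq0.ne'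
  have hlogC : Complex.log (q : ℂ) = (Real.log q : ℂ) := (Complex.ofReal_log hq0.le).symm
  set θ : ℝ := Complex.arg e with hθ
  have heθ : Complex.exp (θ * I) = e := by
    have h := Complex.norm_mul_exp_arg_mul_I e
    rwa [he, Complex.ofReal_one, one_mul] at h
  refine ⟨-θ / (2 * Real.log q), Complex.exp ((θ / 2 : ℝ) * I), ?_, ?_, ?_, fun k z => ?_⟩
  · -- `q^{−tI} = exp(log q · (−tI)) = exp(θ/2 · I)`
    rw [Complex.cpow_def_of_ne_zero hqC, hlogC]
    congr 1
    have : (Real.log q : ℂ) ≠ 0 := by exact_mod_cast hlog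
    push_cast
    field_simp
  · rw [← Complex.exp_nat_mul]
    rw [← heθ]
    congr 1
    push_cast
    ring
  · rw [Complex.cpow_def_of_ne_zero hqC, hlogC, ← heθ]
    congr 1
    have : (Real.log q : ℂ) ≠ 0 := by exact_mod_cast hlog
    push_cast
    field_simp
  · have hqk : (0 : ℝ) < q ^ (2 * k) := pow_pos hq0 _
    have hqkC : (((q ^ (2 * k) : ℝ)) : ℂ) ≠ 0 := by exact_mod_cast hqk.ne'
    have hlogk : Complex.log (((q ^ (2 * k) : ℝ)) : ℂ) = ((2 * k : ℕ) : ℂ) * (Real.log q : ℂ) := by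
      rw [← Complex.ofReal_log hqk.le, Real.log_pow]
      push_cast
      ring
    rw [Complex.cpow_def_of_ne_zero hqkC, Complex.cpow_def_of_ne_zero hqkC, hlogk, ← heθ, ← Complex.exp_nat_mul, ← Complex.exp_add]
    congr 1
    have : (Real.log q : ℂ) ≠ 0 := by exact_mod_cast hlog
    push_cast
    field_simp
    ring

end Shift

/-! ## §3 HEAD — the `χ`-twisted unramified local factor at a good non-split place -/

include hd in
/-- **HEAD — THE `χ`-TWISTED UNRAMIFIED LOCAL FACTOR OF `U(2,1)` AT A GOOD NON-SPLIT PLACE.**  CM pair `L∕L⁺`, `δ ∈ L⁻∖0` with `δ² = d`, a finite place `v` of `L⁺` unramified in `L`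
with `|2|_v = 1`, `δ_w` a unit, `w ∣ v` NON-SPLIT; Haar `ν` on `L⁺_v`; a unit complex number `e` (read `φ_w(ϖ_w)` for the unitary unramified Hecke character `φ` of `L`) and a weight
`ω : (L⁺_v)³ → ℂ` which is SHELL-GEOMETRIC for the local height `Q_v` (letter `hshell`: on `{Q_v = q_v^{2k}}` the weight is `e^k` — the (W)-side reading of an unramified `χ` on the torus
part of the Iwasawa decomposition along the big cell; no measurability needed).  THEN for `1 < Re z`:
`ν(𝒪_v³)⁻¹ · ∫ ω·Q_v^{−z} dν³ = (1 − e·q_v^{−2z})(1 + e·q_v^{−(2z−1)}) ∕ ((1 − e·q_v^{−(2z−2)})(1 + e·q_v^{−(2z−2)}))`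
— the `v`-factor of Rogawski's `L(s,φ)L_{L⁺}(2s,φ′ω)∕(L(s+1,φ)L_{L⁺}(2s+1,φ′ω))` at `s = z − 1` (`φ′ω` at `v`: `e·ω_{L∕L⁺}(ϖ_v) = −e`).  §2 turns the weighted integrand into
`Q_v^{−(z+tI)}`, §1 evaluates the spherical mean at `z + tI`, and the half-angle identities (`q^{−tI} = e'`, `e'² = e`) collapse the token.
[cite: Rogawski1990, §13.9 p. 229] [cite: Langlands1971, §3] [cite: Langlands1976, Appendix] [cite: MoeglinWaldspurger1995, IV.1.11] -/
theorem chiLocalMean_eq_token_of_shell_nonsplit (hunr : Algebra.IsUnramifiedIn (𝓞 L) v.asIdeal) (w : PlacesOver L v) (hw : IsCMField.complexConj L • w.1 = w.1)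
    (h2 : Valued.v (2 : v.adicCompletion ↥(maximalRealSubfield L)) = 1) (hδu : Valued.v (algebraMap L (LocalRing L v) δ w) = 1)
    {e : ℂ} (he : ‖e‖ = 1) (ω : (Fin 3 → v.adicCompletion ↥(maximalRealSubfield L)) → ℂ)
    (hshell : ∀ p : Fin 3 → v.adicCompletion ↥(maximalRealSubfield L), ∃ k : ℕ,
      (∏ w' : PlacesOver L v, max 1 (max ((normAbs (w'.1.adicCompletion L) (quadraticLocalEquiv L v (IsCMField.complexConj L) hcδ hδ (p 0, p 1) w') : ℝ≥0) : ℝ)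
          ((normAbs (w'.1.adicCompletion L) ((toLocalRing L v (p 2) * algebraMap L (LocalRing L v) δ -
            toLocalRing L v 2⁻¹ * (quadraticLocalEquiv L v (IsCMField.complexConj L) hcδ hδ (p 0, p 1) *
              conjLocal L (IsCMField.complexConj L) v (quadraticLocalEquiv L v (IsCMField.complexConj L) hcδ hδ (p 0, p 1)))) w') : ℝ≥0) : ℝ))) =
        (v.residueCard : ℝ) ^ (2 * k) ∧ ω p = e ^ k)
    {z : ℂ} (hz : 1 < z.re) :
    ((((Measure.pi fun _ : Fin 3 => ν) (integralBox ↥(maximalRealSubfield L) (Fin 3) v)).toReal⁻¹ : ℝ) : ℂ) *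
      ∫ p : Fin 3 → v.adicCompletion ↥(maximalRealSubfield L),
        ω p * (((∏ w' : PlacesOver L v, max 1 (max ((normAbs (w'.1.adicCompletion L) (quadraticLocalEquiv L v (IsCMField.complexConj L) hcδ hδ (p 0, p 1) w') : ℝ≥0) : ℝ)
          ((normAbs (w'.1.adicCompletion L) ((toLocalRing L v (p 2) * algebraMap L (LocalRing L v) δ -
            toLocalRing L v 2⁻¹ * (quadraticLocalEquiv L v (IsCMField.complexConj L) hcδ hδ (p 0, p 1) *
              conjLocal L (IsCMField.complexConj L) v (quadraticLocalEquiv L v (IsCMField.complexConj L) hcδ hδ (p 0, p 1)))) w') : ℝ≥0) : ℝ))) : ℝ) : ℂ) ^ (-z)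
        ∂(Measure.pi fun _ : Fin 3 => ν) =
      (1 - e * (v.residueCard : ℂ) ^ (-(2 * z))) * (1 + e * (v.residueCard : ℂ) ^ (-(2 * z - 1))) /
        ((1 - e * (v.residueCard : ℂ) ^ (-(2 * z - 2))) * (1 + e * (v.residueCard : ℂ) ^ (-(2 * z - 2)))) := by
  have hq1 : (1 : ℝ) < (v.residueCard : ℝ) := by exact_mod_cast v.one_lt_residueCard
  have hqC : ((v.residueCard : ℝ) : ℂ) = (v.residueCard : ℂ) := by push_cast; rfl
  have hq0 : (v.residueCard : ℂ) ≠ 0 := by exact_mod_cast (lt_trans zero_lt_one hq1).ne'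
  obtain ⟨t, e', h1, h2', h3, hk⟩ := exists_half_angle he hq1
  rw [hqC] at h1 h3
  -- §2: the weighted integrand is the spherical one at `z + tI`
  have hpt : ∀ p : Fin 3 → v.adicCompletion ↥(maximalRealSubfield L),
      ω p * (((∏ w' : PlacesOver L v, max 1 (max ((normAbs (w'.1.adicCompletion L) (quadraticLocalEquiv L v (IsCMField.complexConj L) hcδ hδ (p 0, p 1) w') : ℝ≥0) : ℝ)
          ((normAbs (w'.1.adicCompletion L) ((toLocalRing L v (p 2) * algebraMap L (LocalRing L v) δ -
            toLocalRing L v 2⁻¹ * (quadraticLocalEquiv L v (IsCMField.complexConj L) hcδ hδ (p 0, p 1) *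
              conjLocal L (IsCMField.complexConj L) v (quadraticLocalEquiv L v (IsCMField.complexConj L) hcδ hδ (p 0, p 1)))) w') : ℝ≥0) : ℝ))) : ℝ) : ℂ) ^ (-z) =
        (((∏ w' : PlacesOver L v, max 1 (max ((normAbs (w'.1.adicCompletion L) (quadraticLocalEquiv L v (IsCMField.complexConj L) hcδ hδ (p 0, p 1) w') : ℝ≥0) : ℝ)
          ((normAbs (w'.1.adicCompletion L) ((toLocalRing L v (p 2) * algebraMap L (LocalRing L v) δ -
            toLocalRing L v 2⁻¹ * (quadraticLocalEquiv L v (IsCMField.complexConj L) hcδ hδ (p 0, p 1) *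
              conjLocal L (IsCMField.complexConj L) v (quadraticLocalEquiv L v (IsCMField.complexConj L) hcδ hδ (p 0, p 1)))) w') : ℝ≥0) : ℝ))) : ℝ) : ℂ) ^ (-(z + t * I)) := fun p => by
    obtain ⟨k, hQ, hω⟩ := hshell p
    rw [hω, hQ]
    exact hk k z
  have hint : ∫ p : Fin 3 → v.adicCompletion ↥(maximalRealSubfield L),
        ω p * (((∏ w' : PlacesOver L v, max 1 (max ((normAbs (w'.1.adicCompletion L) (quadraticLocalEquiv L v (IsCMField.complexConj L) hcδ hδ (p 0, p 1) w') : ℝ≥0) : ℝ)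
          ((normAbs (w'.1.adicCompletion L) ((toLocalRing L v (p 2) * algebraMap L (LocalRing L v) δ -
            toLocalRing L v 2⁻¹ * (quadraticLocalEquiv L v (IsCMField.complexConj L) hcδ hδ (p 0, p 1) *
              conjLocal L (IsCMField.complexConj L) v (quadraticLocalEquiv L v (IsCMField.complexConj L) hcδ hδ (p 0, p 1)))) w') : ℝ≥0) : ℝ))) : ℝ) : ℂ) ^ (-z)
        ∂(Measure.pi fun _ : Fin 3 => ν) =
      ∫ p : Fin 3 → v.adicCompletion ↥(maximalRealSubfield L),
        (((∏ w' : PlacesOver L v, max 1 (max ((normAbs (w'.1.adicCompletion L) (quadraticLocalEquiv L v (IsCMField.complexConj L) hcδ hδ (p 0, p 1) w') : ℝ≥0) : ℝ)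
          ((normAbs (w'.1.adicCompletion L) ((toLocalRing L v (p 2) * algebraMap L (LocalRing L v) δ -
            toLocalRing L v 2⁻¹ * (quadraticLocalEquiv L v (IsCMField.complexConj L) hcδ hδ (p 0, p 1) *
              conjLocal L (IsCMField.complexConj L) v (quadraticLocalEquiv L v (IsCMField.complexConj L) hcδ hδ (p 0, p 1)))) w') : ℝ≥0) : ℝ))) : ℝ) : ℂ) ^ (-(z + t * I))
        ∂(Measure.pi fun _ : Fin 3 => ν) :=
    integral_congr_ae (Eventually.of_forall hpt)
  have hzt : 1 < (z + t * I).re := by simpa using hz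
  rw [hint, localMean_cpow_eq_localScalar_of_nonsplit L hcδ hδ hd v ν hunr w hw h2 hδu hzt,
    valueAtUniformizer_quadraticHeckeCharCM_of_nonsplit L v w hw hunr]
  -- collapse the token: `q^{−(ζ)}` at `ζ = z + tI` splits off `q^{−tI} = e'`, `q^{−2tI} = e`, and `e'² = e`
  have hA : (v.residueCard : ℂ) ^ (-(z + t * I)) = e' * (v.residueCard : ℂ) ^ (-z) := by
    rw [show -(z + t * I) = -(t * I) + -z by ring, Complex.cpow_add _ _ hq0, h1]
  have hB : (v.residueCard : ℂ) ^ (-(2 * (z + t * I) - 1)) = e * (v.residueCard : ℂ) ^ (-(2 * z - 1)) := by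
    rw [show -(2 * (z + t * I) - 1) = -(2 * (t * I)) + -(2 * z - 1) by ring, Complex.cpow_add _ _ hq0, h3]
  have hCc : (v.residueCard : ℂ) ^ (-(z + t * I - 1)) = e' * (v.residueCard : ℂ) ^ (-(z - 1)) := by
    rw [show -(z + t * I - 1) = -(t * I) + -(z - 1) by ring, Complex.cpow_add _ _ hq0, h1]
  have hD : (v.residueCard : ℂ) ^ (-(2 * (z + t * I) - 2)) = e * (v.residueCard : ℂ) ^ (-(2 * z - 2)) := by
    rw [show -(2 * (z + t * I) - 2) = -(2 * (t * I)) + -(2 * z - 2) by ring, Complex.cpow_add _ _ hq0, h3]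
  have hsqA : ((v.residueCard : ℂ) ^ (-z)) ^ 2 = (v.residueCard : ℂ) ^ (-(2 * z)) := by
    rw [← Complex.cpow_nat_mul]; congr 1; push_cast; ring
  have hsqC : ((v.residueCard : ℂ) ^ (-(z - 1))) ^ 2 = (v.residueCard : ℂ) ^ (-(2 * z - 2)) := by
    rw [← Complex.cpow_nat_mul]; congr 1; push_cast; ring
  rw [hA, hB, hCc, hD]
  have hnum : (1 - e' * (v.residueCard : ℂ) ^ (-z)) * (1 - (-1) * (e' * (v.residueCard : ℂ) ^ (-z))) = 1 - e * (v.residueCard : ℂ) ^ (-(2 * z)) := by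
    rw [← hsqA, ← h2']; ring
  have hden : (1 - e' * (v.residueCard : ℂ) ^ (-(z - 1))) * (1 - (-1) * (e' * (v.residueCard : ℂ) ^ (-(z - 1)))) = 1 - e * (v.residueCard : ℂ) ^ (-(2 * z - 2)) := by
    rw [← hsqC, ← h2']; ring
  rw [hnum, hden]
  ring

end Summit.HodgeConjecture.HodgeConjecture.Cruxes.H413.K2E1ChiIntertwiningLocalScalarU3

end
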